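import Summits.BirchSwinnertonDyer.BirchSwinnertonDyer.Theorems.ManinLocalTwoThreeKummerCoverSubgroup
import HarnessLib

/-!
# (AN3) the UDC glue: a MODULAR-FORM WITNESS for the Kummer cube root ⟹ (AN♮) `KummerCubeRootCongruenceOfBoundedOfUDC`
Summit `BirchSwinnertonDyer`, route `ManinLocalTwoThree` (cell bsd-f2-manin), crux C3 `ManinPrimeToThreeAtNine` (stmt-BirchSwinnertonDyer-22968);
lead p1 gen 15 (AN♮ split AN1/AN2/AN3 of the C3 skeleton v22's one content stub, STATUS 14:46Z/15:05Z).  The pure-logic part of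
MEMO-an §80.12 steps (6)–(8): IF, for the data of `UDCKummerLine.KummerCubeRootCongruenceOfBounded` (lattice-optimal datum, rational short
3-torsion point with lift `u`, germ, bounded normalised cube root), there is a MODULAR-FORM WITNESS — an integer `k` and a holomorphic
`F : ℍ → ℂ` with integer `q`-expansion and exponential growth at every cusp such that, for `γ ∈ Γ₀(N)`, `F ∣[k] γ = F` EXACTLY WHEN
`KummerPeriodTrivial D u γ` (i.e. `Γ_T` is the stabiliser of `F` in `Γ₀(N)`; on paper `F = D′ρ⁻¹h·P(j)^eΔ^k` transforms by `ζ₃^{χ_T(γ)}`) — THEN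
the Unbounded Denominators theorem (all weights, `UDCKummerLine.UnboundedDenominatorsWeight`) applied to `Γ_T` (a finite-index subgroup
by the THEOREM `kummerCoverSubgroup_holds`, NC-a) gives `Γ(M)`-invariance, hence `χ_T = 0` on `Γ₀(N) ∩ Γ(M)`.
* `KummerCubeRootModularFormWitness`-shaped hypothesis is written INLINE (no definition; -an to name it as (AN2) if adopted);
* **`kummerCubeRootCongruenceOfBoundedOfUDC_of_modularFormWitness`** : (AN2-shaped witness law) → `KummerCubeRootCongruenceOfBoundedOfUDC`.
So v22's stub AN♮ ⟸ the witness law; the analytic content (S1–S4 leaves, p2's cube-root dictionary p727203, p3's integrality AN1, the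
algebraicity cite flagged by p2) goes entirely into producing the witness.  HONEST FRAMING: CONDITIONAL glue; nothing about C3, Manin's
conjecture or BSD is proved.  No definitions, no sorry.
[cite: CalegariDimitrovTang2025, Thm. 1.0.1] [cite: KurthLong2008, Def. 16 (type II)]
-/

set_option autoImplicit false
-- the summit-side namespace `Summit.BirchSwinnertonDyer.BirchSwinnertonDyer.…` is the tree's (summit = sub-problem)
set_option linter.dupNamespace false

noncomputable section

open PowerSeries CongruenceSubgroup Complex
open scoped MatrixGroups ModularForm UpperHalfPlane Manifold
open WeierstrassCurve Literature.NumberTheory.EllipticCurves Literature.NumberTheory.EllipticCurves.ModularForms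
open Summit.BirchSwinnertonDyer.Rank1Residual.ManinAdditive
open Summit.BirchSwinnertonDyer.Rank1Residual.ManinAdditive.CuspidalKummer
open Summit.BirchSwinnertonDyer.Rank1Residual.ManinAdditive.CuspidalKummerThree
open Summit.BirchSwinnertonDyer.Rank1Residual.ManinAdditive.UDCKummerLine

namespace Summit.BirchSwinnertonDyer.BirchSwinnertonDyer.Theorems.ManinLocalTwoThree

/-- **(AN3) UDC glue.**  A modular-form witness with stabiliser `Γ_T` for every bounded normalised cube root ⟹ (AN♮).
CONDITIONAL on the witness law (= the analytic content of MEMO-an §80.12 step (6)); uses NC-a (`kummerCoverSubgroup_holds`).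
[cite: CalegariDimitrovTang2025, Thm. 1.0.1] -/
theorem kummerCubeRootCongruenceOfBoundedOfUDC_of_modularFormWitness
    (hMF : ∀ (W : WeierstrassCurve ℚ) [W.IsElliptic] [W.IsGloballyMinimal] {N : ℕ} [NeZero N]
      (D : ModularParametrizationData W N) (a : ℕ → ℤ), (∀ n, (a n : ℂ) = cuspCoeff D.f n) →
      (∀ z ∈ D.L.lattice, ∃ w ∈ periodLattice D.f, z = D.c * w) →
      ∀ X₀ Y₀ : ℚ, IsShortThreeTorsion W D.c X₀ Y₀ →
      ∀ u : ℂ, u ∉ D.L.lattice → 3 * u ∈ D.L.lattice →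
      (D.c : ℂ) ^ 2 * D.L.weierstrassP u = (X₀ : ℂ) → (D.c : ℂ) ^ 3 * D.L.derivWeierstrassP u / 2 = (Y₀ : ℂ) →
      ∀ z : ℚ⟦X⟧, IsParamGerm W D.c a z →
      ∀ h : ℚ⟦X⟧, h ^ 3 = kummerCubeSeries W D.c X₀ Y₀ z → constantCoeff h = -1 → IsThreeAdicallyBounded h →
      ∃ (k : ℤ) (F : ℍ → ℂ), MDifferentiable 𝓘(ℂ) 𝓘(ℂ) F ∧
        (∀ γ : Gamma0 N, KummerPeriodTrivial D u γ → F ∣[k] (γ : SL(2, ℤ)) = F) ∧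
        (∀ γ : Gamma0 N, F ∣[k] (γ : SL(2, ℤ)) = F → KummerPeriodTrivial D u γ) ∧
        (∀ g : SL(2, ℤ), ∃ C A m : ℝ, ∀ τ : ℍ, A ≤ τ.im → ‖(F ∣[k] g) τ‖ ≤ C * Real.exp (m * τ.im)) ∧
        (∃ b : ℕ → ℤ, ∀ τ : ℍ,
          HasSum (fun n : ℕ ↦ (b n : ℂ) * Complex.exp (2 * Real.pi * Complex.I * (τ : ℂ) * n)) (F τ))) :
    KummerCubeRootCongruenceOfBoundedOfUDC := by
  intro hUDC W _ _ N _ D a ha hopt X₀ Y₀ hT u hu h3u hX hY z hz h hh3 hh0 hK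
  obtain ⟨k, F, hhol, hinv, hstab, hgrowth, hq⟩ := hMF W D a ha hopt X₀ Y₀ hT u hu h3u hX hY z hz h hh3 hh0 hK
  obtain ⟨Γ, hmem, hle, hfi, -, -⟩ := kummerCoverSubgroup_holds W D hopt u hu h3u
  have hΓinv : ∀ γ ∈ Γ, F ∣[k] γ = F := by
    intro γ hγ
    have hγ0 : γ ∈ Gamma0 N := hle hγ
    exact hinv ⟨γ, hγ0⟩ ((hmem ⟨γ, hγ0⟩).mp hγ)
  obtain ⟨M, hM, hcong⟩ := hUDC k Γ hfi F hhol hΓinv hgrowth hq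
  exact ⟨M, hM, fun γ hγ ↦ hstab γ (hcong _ hγ)⟩

end Summit.BirchSwinnertonDyer.BirchSwinnertonDyer.Theorems.ManinLocalTwoThree

end
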